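import Literature.Analysis.FluidPDE.TaoH1AlmostRegular
import Literature.Analysis.FluidPDE.TaoH1APrioriProofs
import Literature.Analysis.FluidPDE.ClassicalL2Stability
import Literature.Analysis.FluidPDE.MollifiedH1Data
import Literature.Analysis.FluidPDE.SmoothRepresentative
import Literature.Analysis.FluidPDE.LimitLerayHopf
import Literature.Analysis.FluidPDE.LerayHopfRestart
import HarnessLib

/-!
# Tao 2013, Theorem 5.4 (ii) for `H¹` data: assembly from the smooth local theory

Analysis/FluidPDE proof file (no named facts). We prove
`tao2011_H1_local_almost_regular_of_smooth_local_existence`: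
the smooth local existence theory `tao2011_smooth_local_existence` (Tao 2013, Thm. 5.4 (i)+(iv),
a named fact of `TaoH1LocalExistence.lean`) implies the `H¹` statement
`tao2011_H1_local_almost_regular` (`TaoH1AlmostRegular.lean`; Tao 2013, Thm. 5.4 (ii) with
Lemma 5.5 / Prop. 5.6: an `H¹` datum with `‖u₀‖²_{H¹} ≤ A`, `A²T ≤ cν³`, launches a Leray–Hopf
solution on `[0, T)` which is `H¹`-regular on `[0, T]` and smooth (classical of Tao's class) on
every `[τ, T]`, `τ > 0`).

The proof is the classical approximation argument (Leray 1934, §§31–33; Robinson–Rodrigo–Sadowski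
2016, proofs of Thm. 6.8 and Thm. 7.3; Tao 2013, §5): mollify the datum
(`MollifiedH1Data.lean`), solve classically on `[0, T]` with lifespan given by the enstrophy a
priori bound (`exists_leray_enstrophy_apriori`, the smallness `A²T ≤ cν³`), get uniform bounds
of all orders at positive times (`tao2011_quantitative_regularity_holds`) and an `L²`-Cauchy
property from the `L²` stability estimate (`exists_l2_stability`), pass to the limit
(`exists_isLerayHopfOn_of_uniform_cauchy`), and recover smoothness for positive times by
restarting the smooth local theory from a smooth representative of a slice
(`exists_smooth_representative`) and weak–strong uniqueness (`serrin_weak_strong_uniqueness_holds`).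
`H¹`-regularity at `t = 0⁺` combines the lower semicontinuity of the weak dissipation under `L²`
convergence (`eWeakGradL2Sq_le_liminf_of_tendsto_eLpNorm`) with the cubic enstrophy inequality
(`exists_enstrophy_cubic_ineq`).

## References

* T. Tao, Localisation and compactness properties of the Navier–Stokes global regularity problem,
  Anal. PDE 6 (2013) 25–107, Thm. 5.4, Lemma 5.5, Prop. 5.6. [Tao2011]
* J. C. Robinson, J. L. Rodrigo, W. Sadowski, *The three-dimensional Navier–Stokes equations*,
  CUP 2016, Thm. 6.8, Cor. 6.9, Thm. 7.3, Thm. 8.17. [RobinsonRodrigoSadowski2016]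
-/

noncomputable section

open MeasureTheory TopologicalSpace Set Function Filter Topology ContinuousLinearMap
open scoped InnerProductSpace RealInnerProductSpace ENNReal NNReal Interval

namespace Literature.Analysis.FluidPDE

/-! ## Changing the datum on a null set -/

section Datum

variable {E : Type*} [NormedAddCommGroup E] [InnerProductSpace ℝ E] [FiniteDimensional ℝ E]
  [MeasurableSpace E] [BorelSpace E]

/-- The kinetic energy only depends on the a.e. class of the field. [folklore] -/
theorem kineticEnergy_congr_ae {v v' : E → E} (h : v =ᵐ[volume] v') :
    VectorCalculus.kineticEnergy v = VectorCalculus.kineticEnergy v' := by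
  unfold VectorCalculus.kineticEnergy
  rw [integral_congr_ae (show (fun x => ‖v x‖ ^ 2) =ᵐ[volume] fun x => ‖v' x‖ ^ 2 from
    h.mono fun x hx => by simp only [hx])]

/-- **Leray–Hopf solutions only see the a.e. class of the datum**: if `u` is Leray–Hopf from
`u₀` and `u₀' = u₀` a.e., then `u` is Leray–Hopf from `u₀'` (the datum enters through
`∫⟪u₀, ψ(0)⟫`, `E(u₀)`, `∫⟪u₀, w⟫` and `‖u(t) - u₀‖₂` only). [folklore] -/
theorem IsLerayHopfOn.congr_datum_ae {T ν : ℝ} {f u : ℝ → E → E} {u₀ u₀' : E → E}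
    (h : FluidPDE.IsLerayHopfOn T ν f u₀ u) (h0 : u₀' =ᵐ[volume] u₀) :
    FluidPDE.IsLerayHopfOn T ν f u₀' u := by
  have hinner : ∀ w : E → E, ∫ x, ⟪u₀' x, w x⟫ = ∫ x, ⟪u₀ x, w x⟫ := fun w =>
    integral_congr_ae (h0.mono fun x hx => by simp only [hx])
  have hkin : VectorCalculus.kineticEnergy u₀' = VectorCalculus.kineticEnergy u₀ :=
    kineticEnergy_congr_ae h0
  obtain ⟨hw1, hw2, hw3, hw4⟩ := h.weak
  obtain ⟨G, hG, hGint, hE0, hEs⟩ := h.weakGrad_energy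
  refine ⟨⟨hw1, hw2, hw3, fun ψ hψ hdiv => ?_⟩, h.energy_bound, h.memLp, ⟨G, hG, hGint, fun t ht => ?_, hEs⟩,
    fun w hw => ⟨(h.weak_continuous w hw).1, ?_⟩, ?_⟩
  · rw [hinner]; exact hw4 ψ hψ hdiv
  · rw [hkin]; exact hE0 t ht
  · rw [hinner]; exact (h.weak_continuous w hw).2
  · have heq : ∀ t, eLpNorm (u t - u₀') 2 volume = eLpNorm (u t - u₀) 2 volume := fun t =>
      eLpNorm_congr_ae (h0.mono fun x hx => by simp only [Pi.sub_apply, hx])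
    simp_rw [heq]
    exact h.strong_initial

end Datum

/-! ## Small conversions -/

section Conversions

/-- `∫⁻ ‖f‖ₑ² = ofReal ∫ ‖f‖²` for `f ∈ L²`. [folklore] -/
theorem lintegral_enorm_sq_eq_ofReal_integral {f : (EuclideanSpace ℝ (Fin 3)) → (EuclideanSpace ℝ (Fin 3))} (hf : MemLp f 2 volume) :
    ∫⁻ x, ‖f x‖ₑ ^ 2 = ENNReal.ofReal (∫ x, ‖f x‖ ^ 2) := by
  have h := FluidPDE.eEnergy_eq_ofReal f hf
  rw [FluidPDE.eEnergy, VectorCalculus.kineticEnergy] at h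
  rw [h]; congr 1; ring

/-- `‖f‖₂ ≤ ε` from `∫⁻ ‖f‖ₑ² ≤ ε²`. [folklore] -/
theorem eLpNorm_two_le_of_lintegral_le_sq {f : (EuclideanSpace ℝ (Fin 3)) → (EuclideanSpace ℝ (Fin 3))} {ε : ℝ≥0∞}
    (h : ∫⁻ x, ‖f x‖ₑ ^ 2 ≤ ε ^ 2) : eLpNorm f 2 volume ≤ ε := by
  have h2 : eLpNorm f 2 volume ^ 2 ≤ ε ^ 2 := by
    rw [← FluidPDE.eEnergy_eq_eLpNorm_sq]; exact h
  exact (ENNReal.pow_le_pow_left_iff two_ne_zero).1 h2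

/-- In the Tao class the energy of every slice is at most the energy of the datum:
`∫⁻ ‖u(t)‖ₑ² ≤ ofReal (2 E(u(0)))`. [cite: Tao2011, Thm. 5.4 (i)] -/
theorem lintegral_enorm_sq_le_of_taoClass {ν T : ℝ} (hT : 0 < T) (hν : 0 ≤ ν)
    {u : ℝ → (EuclideanSpace ℝ (Fin 3)) → (EuclideanSpace ℝ (Fin 3))} {p : ℝ → (EuclideanSpace ℝ (Fin 3)) → ℝ} (hsol : FluidPDE.IsClassicalNSSolutionOn (Icc 0 T) ν 0 u p)
    (hu : HasBoundedSobolevNormsOn (Icc 0 T) u)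
    (hp : ∀ n : ℕ, ∃ C : ℝ≥0, ∀ t ∈ Icc 0 T, ∫⁻ x, ‖iteratedFDeriv ℝ n (p t) x‖ₑ ^ 2 ≤ C)
    (hc : FluidPDE.ContinuousInLpOn (Icc 0 T) 2 u) {t : ℝ} (ht : t ∈ Icc 0 T) :
    ∫⁻ x, ‖u t x‖ₑ ^ 2 ≤ ENNReal.ofReal (2 * VectorCalculus.kineticEnergy (u 0)) := by
  have h := kineticEnergy_le_of_hasBoundedSobolevNormsOn hT hν hsol hu hp hc le_rfl ht.1 ht.2
  have he := FluidPDE.eEnergy_eq_ofReal (u t) (hc.1 t ht)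
  rw [FluidPDE.eEnergy] at he
  rw [he]
  exact ENNReal.ofReal_le_ofReal (by linarith)

end Conversions

/-! ## Classical representatives from a restart and weak–strong uniqueness -/

section Restart

/-- **Smooth representative on `[τ, T]` by restart and weak–strong uniqueness** (Tao 2013, proof
of Thm. 5.4 (ii)–(iii) via Prop. 5.6 and uniqueness; Robinson–Rodrigo–Sadowski 2016, Thm. 8.17
with Thm. 6.8). Let `v(· + s)` be Leray–Hopf on `[0, T - s)` from `v(s)` (`s` a restart time),
and let `(W, P)` be a classical solution of Tao's class on `[0, T - s]` with `W(0) = v(s)` a.e.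
Then `v(t + s) = W(t)` a.e. for `t ∈ (0, T - s]` (weak–strong uniqueness in Serrin's class
`L^∞L^∞`, `serrin_weak_strong_uniqueness_holds`), so that `w = W(· - s)`, `π = P(· - s)` is a
classical representative of `v` on every `[τ, T]`, `s < τ < T`, again of Tao's class, with
continuous enstrophy. [cite: Tao2011, Thm. 5.4 (ii)-(iii)] -/
theorem exists_classical_rep_of_restart {ν T s τ : ℝ} (hν : 0 < ν) (hsτ : s < τ)
    (hτT : τ < T) {v : ℝ → (EuclideanSpace ℝ (Fin 3)) → (EuclideanSpace ℝ (Fin 3))} (hvs : MemLp (v s) 2 volume)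
    (hLHs : FluidPDE.IsLerayHopfOn (T - s) ν 0 (v s) (fun t => v (t + s)))
    {W : ℝ → (EuclideanSpace ℝ (Fin 3)) → (EuclideanSpace ℝ (Fin 3))} {P : ℝ → (EuclideanSpace ℝ (Fin 3)) → ℝ}
    (hW : FluidPDE.IsClassicalNSSolutionOn (Icc 0 (T - s)) ν 0 W P)
    (hW0 : W 0 =ᵐ[volume] v s) (hWB : HasBoundedSobolevNormsOn (Icc 0 (T - s)) W)
    (hWB' : HasBoundedSobolevNormsOn (Icc 0 (T - s)) (FluidPDE.timeDerivWithin (Icc 0 (T - s)) W))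
    (hPB : ∀ n : ℕ, ∃ C : ℝ≥0, ∀ t ∈ Icc 0 (T - s), ∫⁻ x, ‖iteratedFDeriv ℝ n (P t) x‖ₑ ^ 2 ≤ C)
    (hWc : FluidPDE.ContinuousInLpOn (Icc 0 (T - s)) 2 W) :
    ∃ (w : ℝ → (EuclideanSpace ℝ (Fin 3)) → (EuclideanSpace ℝ (Fin 3))) (π : ℝ → (EuclideanSpace ℝ (Fin 3)) → ℝ),
      FluidPDE.IsClassicalNSSolutionOn (Icc τ T) ν 0 w π ∧ HasBoundedSobolevNormsOn (Icc τ T) w ∧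
      HasBoundedSobolevNormsOn (Icc τ T) (FluidPDE.timeDerivWithin (Icc τ T) w) ∧
      (∀ n : ℕ, ∃ C : ℝ≥0, ∀ t ∈ Icc τ T, ∫⁻ x, ‖iteratedFDeriv ℝ n (π t) x‖ₑ ^ 2 ≤ C) ∧
      (∀ t ∈ Icc τ T, v t =ᵐ[volume] w t) ∧
      ContinuousOn (fun t => ∫⁻ x, ENNReal.ofReal (FluidPDE.frobeniusNormSq (fderiv ℝ (w t) x)))
        (Icc τ T) := by
  have hTs : 0 < T - s := by linarith
  -- `W` is Leray–Hopf from `v s`, bounded, hence equal to the restart a.e.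
  have hLHW : FluidPDE.IsLerayHopfOn (T - s) ν 0 (v s) W :=
    (isLerayHopfOn_of_hasBoundedSobolevNormsOn hTs hW hWB hPB hWc).congr_datum_ae hW0.symm
  obtain ⟨B, hB0, hB⟩ := exists_forall_norm_le_of_hasBoundedSobolevNormsOn hW hWB
  have hS : FluidPDE.MemLqLp ∞ ∞ W (Ioo 0 (T - s)) :=
    memLqLp_top_top_of_forall_norm_le measurableSet_Ioo hB0
      (fun t ht => (hW.contDiff_velocity (Ioo_subset_Icc_self ht)).continuous)
      fun t ht x => hB t (Ioo_subset_Icc_self ht) x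
  have hae : ∀ t ∈ Ioc 0 (T - s), v (t + s) =ᵐ[volume] W t :=
    serrin_weak_strong_uniqueness_holds hν hTs hLHW hvs (q := ⊤) (r := ⊤) (by simp) (by simp) hS hLHs
  -- the translated classical solution
  have hpre : Icc τ T ⊆ (· + -s) ⁻¹' Icc 0 (T - s) := fun t ht =>
    ⟨by linarith [ht.1], by linarith [ht.2]⟩
  have hsolw : FluidPDE.IsClassicalNSSolutionOn (Icc τ T) ν 0 (fun t => W (t + -s)) fun t => P (t + -s) :=
    (hW.comp_add_right (-s)).mono hpre (uniqueDiffOn_Icc hτT)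
  have htd : ∀ t ∈ Icc τ T, FluidPDE.timeDerivWithin (Icc τ T) (fun t => W (t + -s)) t =
      FluidPDE.timeDerivWithin (Icc 0 (T - s)) W (t + -s) := by
    intro t ht
    funext x
    rw [(hW.comp_add_right (-s)).smooth_velocity.timeDerivWithin_eq_of_subset hpre
      (uniqueDiffOn_Icc hτT) ht x]
    exact timeDerivWithin_comp_add_right _ W (-s) t x
  -- continuity of the enstrophy
  obtain ⟨κ, -, hcubic⟩ := exists_enstrophy_cubic_ineq
  obtain ⟨hGc, -, -, hGeq⟩ := hcubic hν hTs hW hWB hWB' hPB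
  refine ⟨fun t => W (t + -s), fun t => P (t + -s), hsolw,
    fun n => (hWB n).imp fun C hC t ht => hC (t + -s) (hpre ht),
    fun n => (hWB' n).imp fun C hC t ht => ?_,
    fun n => (hPB n).imp fun C hC t ht => hC (t + -s) (hpre ht), fun t ht => ?_, ?_⟩
  · rw [htd t ht]; exact hC (t + -s) (hpre ht)
  · have ht' : t + -s ∈ Ioc 0 (T - s) := ⟨by linarith [ht.1], by linarith [ht.2]⟩
    have h := hae (t + -s) ht'
    rwa [neg_add_cancel_right] at h
  · have hc : ContinuousOn (fun t => ENNReal.ofReal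
        (∫ x, FluidPDE.frobeniusNormSq (fderiv ℝ (W (t + -s)) x))) (Icc τ T) :=
      ENNReal.continuous_ofReal.comp_continuousOn
        (hGc.comp (continuousOn_id.add continuousOn_const) hpre)
    exact hc.congr fun t ht => (hGeq (t + -s) (hpre ht)).symm

end Restart

/-! ## `H¹`-regularity of the limit -/

section H1Regular

set_option maxHeartbeats 800000 in
/-- **`H¹`-regularity on `[0, T]` from smooth representatives at positive times and the
behaviour at `t = 0⁺`** (Tao 2013, Thm. 5.4 (ii): `u ∈ C⁰_t H¹_x([0,T] × ℝ³)`, here for the norm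
`t ↦ ‖u(t)‖²_{H¹}` of `IsH1RegularOn`). Let `v ∈ C([0,T]; L²)` have, on every `[τ, T]` with
`τ > 0`, a representative with `C¹` slices and continuous enstrophy, and suppose
`‖∇v(t)‖²₂ ≤ D₀ + L t` with `D₀ = ‖∇v(0)‖²₂`. Then `t ↦ ‖v(t)‖²_{H¹}` is finite and continuous on
`[0, T]`: on `(0, T]` by the representatives; at `0⁺` the upper bound gives
`limsup ≤ ‖v(0)‖²_{H¹}` and the lower semicontinuity of the weak dissipation under `L²`
convergence (`eWeakGradL2Sq_le_liminf_of_tendsto_eLpNorm`, along sequences of the smooth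
representatives) gives `liminf ≥ ‖v(0)‖²_{H¹}`. [cite: Tao2011, Thm. 5.4 (ii)] -/
theorem isH1RegularOn_of_rep {T : ℝ} (hT : 0 < T) {v : ℝ → (EuclideanSpace ℝ (Fin 3)) → (EuclideanSpace ℝ (Fin 3))}
    (hcv : FluidPDE.ContinuousInLpOn (Icc 0 T) 2 v)
    (hrep : ∀ τ ∈ Ioo 0 T, ∃ w : ℝ → (EuclideanSpace ℝ (Fin 3)) → (EuclideanSpace ℝ (Fin 3)), (∀ t ∈ Icc τ T, ContDiff ℝ 1 (w t)) ∧
      (∀ t ∈ Icc τ T, v t =ᵐ[volume] w t) ∧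
      ContinuousOn (fun t => ∫⁻ x, ENNReal.ofReal (FluidPDE.frobeniusNormSq (fderiv ℝ (w t) x)))
        (Icc τ T))
    {D₀ L : ℝ} (hD₀ : eWeakGradL2Sq (v 0) = ENNReal.ofReal D₀)
    (hup : ∀ t ∈ Icc 0 T, eWeakGradL2Sq (v t) ≤ ENNReal.ofReal (D₀ + L * t)) :
    IsH1RegularOn (Icc 0 T) v := by
  have h0I : (0 : ℝ) ∈ Icc 0 T := left_mem_Icc.2 hT.le
  -- the energy through the `L²` lift
  obtain ⟨U, hUc, hUeq⟩ := hcv.exists_continuousOn_toLp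
  set e : ℝ → ℝ≥0∞ := fun t => ENNReal.ofReal ‖U t‖ ^ 2 with he_def
  have he : ∀ t ∈ Icc 0 T, FluidPDE.eEnergy (v t) = e t := by
    intro t ht
    rw [FluidPDE.eEnergy_eq_eLpNorm_sq, he_def]
    dsimp only
    rw [hUeq t ht, Lp.norm_toLp, ENNReal.ofReal_toReal (hcv.1 t ht).eLpNorm_ne_top]
  have hec : ContinuousOn e (Icc 0 T) :=
    (ENNReal.continuous_pow 2).comp_continuousOn
      ((ENNReal.continuous_ofReal.comp continuous_norm).comp_continuousOn hUc)
  have hetop : ∀ t ∈ Icc 0 T, e t ≠ ⊤ := fun t _ => ENNReal.pow_ne_top ENNReal.ofReal_ne_top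
  -- smooth representatives compute the weak dissipation
  have hrepW : ∀ {w : (EuclideanSpace ℝ (Fin 3)) → (EuclideanSpace ℝ (Fin 3))} {t : ℝ}, ContDiff ℝ 1 w → v t =ᵐ[volume] w →
      eWeakGradL2Sq (v t) = ∫⁻ x, ENNReal.ofReal (FluidPDE.frobeniusNormSq (fderiv ℝ w x)) :=
    fun hw hae => (eWeakGradL2Sq_congr_ae hae).trans
      (eWeakGradL2Sq_eq_of_hasWeakGradient (hasWeakGradient_fderiv_of_contDiff hw))
  -- finiteness
  have hfin : ∀ t ∈ Icc 0 T, eH1NormSq (v t) < ⊤ := fun t ht => by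
    rw [eH1NormSq_def]
    exact ENNReal.add_lt_top.2 ⟨(he t ht).trans_lt (lt_top_iff_ne_top.2 (hetop t ht)),
      (hup t ht).trans_lt ENNReal.ofReal_lt_top⟩
  refine ⟨hfin, fun t₀ ht₀ => ?_⟩
  rcases eq_or_lt_of_le ht₀.1 with h00 | hpos
  · -- continuity at `t₀ = 0`
    subst h00
    refine (continuousWithinAt_sdiff_self (s := Icc (0 : ℝ) T)).1 ?_
    rw [Icc_sdiff_left]
    have hle : 𝓝[Ioc (0 : ℝ) T] 0 ≤ 𝓝[Icc 0 T] 0 := nhdsWithin_mono _ Ioc_subset_Icc_self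
    have hf0 : eH1NormSq (v 0) = e 0 + ENNReal.ofReal D₀ := by rw [eH1NormSq_def, he 0 h0I, hD₀]
    refine tendsto_order.2 ⟨fun b hb => ?_, fun b hb => ?_⟩
    · -- lower semicontinuity
      by_contra H
      have hfr : ∃ᶠ t in 𝓝[Ioc (0 : ℝ) T] 0, eH1NormSq (v t) ≤ b ∧ t ∈ Ioc (0 : ℝ) T :=
        ((not_eventually.1 H).mono fun t ht => not_lt.1 ht).and_eventually eventually_mem_nhdsWithin
      obtain ⟨tk, htk, hPk⟩ := exists_seq_forall_of_frequently hfr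
      have htkI : ∀ k, tk k ∈ Icc 0 T := fun k => Ioc_subset_Icc_self (hPk k).2
      have htk' : Tendsto tk atTop (𝓝[Icc 0 T] 0) := htk.mono_right hle
      -- smooth representatives of `v (tk k)`
      have hrk : ∀ k, ∃ w : (EuclideanSpace ℝ (Fin 3)) → (EuclideanSpace ℝ (Fin 3)), ContDiff ℝ 1 w ∧ v (tk k) =ᵐ[volume] w := by
        intro k
        have hk := (hPk k).2
        obtain ⟨w, hw1, hw2, -⟩ := hrep (tk k / 2) ⟨by linarith [hk.1], by linarith [hk.2]⟩
        exact ⟨w (tk k), hw1 _ ⟨by linarith [hk.1], hk.2⟩, hw2 _ ⟨by linarith [hk.1], hk.2⟩⟩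
      choose g hg1 hg2 using hrk
      set d : ℕ → ℝ≥0∞ := fun k => ∫⁻ x, ENNReal.ofReal (FluidPDE.frobeniusNormSq (fderiv ℝ (g k) x))
        with hd_def
      have hdk : ∀ k, eWeakGradL2Sq (v (tk k)) = d k := fun k => hrepW (hg1 k) (hg2 k)
      have hfk : ∀ k, eH1NormSq (v (tk k)) = e (tk k) + d k := fun k => by
        rw [eH1NormSq_def, he _ (htkI k), hdk k]
      -- lower semicontinuity of the weak dissipation along `g k → v 0`
      have hbtop : b < ⊤ := hb.trans_le le_top
      have hstrong : Tendsto (fun k => eLpNorm (g k - v 0) 2 volume) atTop (𝓝 0) := by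
        have h1 : Tendsto (fun k => eLpNorm (v (tk k) - v 0) 2 volume) atTop (𝓝 0) :=
          (hcv.2 0 h0I).comp htk'
        refine h1.congr fun k => eLpNorm_congr_ae ?_
        filter_upwards [hg2 k] with x hx
        simp only [Pi.sub_apply, hx]
      have hlsc : eWeakGradL2Sq (v 0) ≤ liminf d atTop := by
        refine eWeakGradL2Sq_le_liminf_of_tendsto_eLpNorm hg1
          (fun k => (hcv.1 _ (htkI k)).ae_eq (hg2 k)) (hcv.1 0 h0I) hstrong ?_
        refine lt_of_le_of_lt (liminf_le_of_frequently_le' (Frequently.of_forall fun k => ?_)) hbtop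
        calc d k ≤ e (tk k) + d k := le_add_self
          _ = eH1NormSq (v (tk k)) := (hfk k).symm
          _ ≤ b := (hPk k).1
      -- the energies converge
      have hek : Tendsto (fun k => e (tk k)) atTop (𝓝 (e 0)) := (hec 0 h0I).tendsto.comp htk'
      -- conclusion: `e 0 + D₀ ≤ b`, contradicting `b < ‖v 0‖²_{H¹}`
      have hmain : e 0 + eWeakGradL2Sq (v 0) ≤ b := by
        refine ENNReal.le_of_forall_pos_le_add fun δ hδ _ => ?_
        have hδ' : (0 : ℝ≥0∞) < δ := by exact_mod_cast hδ
        have hev : ∀ᶠ k in atTop, e 0 - δ ≤ e (tk k) := by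
          have := (ENNReal.tendsto_nhds (hetop 0 h0I)).1 hek δ hδ'
          exact this.mono fun k hk => hk.1
        have hlim1 : liminf (fun k => (e 0 - δ) + d k) atTop ≤ b := by
          refine liminf_le_of_frequently_le' ((hev.mono fun k hk => ?_).frequently)
          calc e 0 - δ + d k ≤ e (tk k) + d k := add_le_add hk le_rfl
            _ = eH1NormSq (v (tk k)) := (hfk k).symm
            _ ≤ b := (hPk k).1
        have hmono : Monotone fun x : ℝ≥0∞ => (e 0 - δ) + x := fun x y hxy => add_le_add le_rfl hxy
        have hlim2 : (e 0 - δ) + liminf d atTop = liminf (fun k => (e 0 - δ) + d k) atTop :=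
          hmono.map_liminf_of_continuousAt d (continuous_const_add _).continuousAt
        calc e 0 + eWeakGradL2Sq (v 0) ≤ (e 0 - δ + δ) + liminf d atTop :=
              add_le_add le_tsub_add hlsc
          _ = (e 0 - δ) + liminf d atTop + δ := by ring
          _ ≤ b + δ := by rw [hlim2]; exact add_le_add hlim1 le_rfl
      have hb' : b < e 0 + eWeakGradL2Sq (v 0) := by rw [hD₀, ← hf0]; exact hb
      exact absurd hmain (not_le.2 hb')
    · -- upper bound
      have hcont : ContinuousWithinAt (fun t => e t + ENNReal.ofReal (D₀ + L * t)) (Icc 0 T) 0 :=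
        (hec 0 h0I).add ((ENNReal.continuous_ofReal.comp (continuous_const.add
          (continuous_const.mul continuous_id))).continuousWithinAt)
      have h0 : e 0 + ENNReal.ofReal (D₀ + L * 0) = eH1NormSq (v 0) := by rw [mul_zero, add_zero, hf0]
      have hT' : Tendsto (fun t => e t + ENNReal.ofReal (D₀ + L * t)) (𝓝[Icc (0 : ℝ) T] 0)
          (𝓝 (eH1NormSq (v 0))) := by
        rw [← h0]; exact hcont.tendsto
      have hev : ∀ᶠ t in 𝓝[Icc (0 : ℝ) T] 0, e t + ENNReal.ofReal (D₀ + L * t) < b :=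
        (tendsto_order.1 hT').2 b hb
      filter_upwards [hle hev, hle eventually_mem_nhdsWithin] with t ht htI
      calc eH1NormSq (v t) = e t + eWeakGradL2Sq (v t) := by rw [eH1NormSq_def, he t htI]
        _ ≤ e t + ENNReal.ofReal (D₀ + L * t) := add_le_add le_rfl (hup t htI)
        _ < b := ht
  · -- continuity at `t₀ > 0` through a representative on `[t₀/2, T]`
    set τ := t₀ / 2 with hτ
    have hτI : τ ∈ Ioo 0 T := ⟨by rw [hτ]; linarith, by rw [hτ]; linarith [ht₀.2]⟩
    obtain ⟨w, hw1, hwae, hwc⟩ := hrep τ hτI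
    have hmem : Icc τ T ∈ 𝓝[Icc 0 T] t₀ := by
      refine mem_nhdsWithin.2 ⟨Ioi τ, isOpen_Ioi, (by rw [mem_Ioi, hτ]; linarith : t₀ ∈ Ioi τ), ?_⟩
      rintro t ⟨ht1, ht2⟩
      exact ⟨le_of_lt ht1, ht2.2⟩
    refine ContinuousWithinAt.mono_of_mem_nhdsWithin ?_ hmem
    have hcong : EqOn (fun t => eH1NormSq (v t))
        (fun t => e t + ∫⁻ x, ENNReal.ofReal (FluidPDE.frobeniusNormSq (fderiv ℝ (w t) x))) (Icc τ T) := by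
      intro t ht
      have htI : t ∈ Icc 0 T := ⟨hτI.1.le.trans ht.1, ht.2⟩
      show eH1NormSq (v t) = e t + _
      rw [eH1NormSq_def, he t htI, hrepW (hw1 t ht) (hwae t ht)]
    have hc : ContinuousOn (fun t => e t + ∫⁻ x, ENNReal.ofReal
        (FluidPDE.frobeniusNormSq (fderiv ℝ (w t) x))) (Icc τ T) :=
      (hec.mono (Icc_subset_Icc hτI.1.le le_rfl)).add hwc
    exact (hc.congr hcong) t₀ ⟨by rw [hτ]; linarith, ht₀.2⟩

end H1Regular

/-! ## The approximation scheme: Cauchy property and smooth slices of the limit -/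

section Scheme

variable {ν T : ℝ} {u : ℕ → ℝ → (EuclideanSpace ℝ (Fin 3)) → (EuclideanSpace ℝ (Fin 3))} {p : ℕ → ℝ → (EuclideanSpace ℝ (Fin 3)) → ℝ} {u₀ : (EuclideanSpace ℝ (Fin 3)) → (EuclideanSpace ℝ (Fin 3))}

set_option maxHeartbeats 800000 in
/-- **Uniform `L²`-Cauchy property of the approximants** from the `L²` stability estimate
(`exists_l2_stability`; Robinson–Rodrigo–Sadowski 2016, proof of Thm. 6.10): classical
solutions of Tao's class on `[0, T]` with enstrophies `≤ S` and data converging in `L²` are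
uniformly Cauchy in `C([0,T]; L²)`. [cite: RobinsonRodrigoSadowski2016, Thm. 6.10 (proof)] -/
theorem uniform_cauchy_of_stability (hν : 0 < ν) (hT : 0 < T)
    (hsol : ∀ n, FluidPDE.IsClassicalNSSolutionOn (Icc 0 T) ν 0 (u n) (p n))
    (hu : ∀ n, HasBoundedSobolevNormsOn (Icc 0 T) (u n))
    (hu' : ∀ n, HasBoundedSobolevNormsOn (Icc 0 T) (FluidPDE.timeDerivWithin (Icc 0 T) (u n)))
    (hp : ∀ n (k : ℕ), ∃ C : ℝ≥0, ∀ t ∈ Icc 0 T, ∫⁻ x, ‖iteratedFDeriv ℝ k (p n t) x‖ₑ ^ 2 ≤ C)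
    (hc : ∀ n, FluidPDE.ContinuousInLpOn (Icc 0 T) 2 (u n)) {S : ℝ}
    (hS : ∀ n, ∀ t ∈ Icc 0 T, ∫ x, FluidPDE.frobeniusNormSq (fderiv ℝ (u n t) x) ≤ S)
    (hu₀ : MemLp u₀ 2 volume) (h0 : Tendsto (fun n => eLpNorm (u n 0 - u₀) 2 volume) atTop (𝓝 0)) :
    ∀ ε : ℝ≥0∞, 0 < ε → ∃ N, ∀ n ≥ N, ∀ m ≥ N, ∀ t ∈ Icc 0 T,
      eLpNorm (u n t - u m t) 2 volume ≤ ε := by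
  obtain ⟨Cst, hCst, hstab⟩ := exists_l2_stability
  set e : ℝ := Real.exp (Cst * (ν ^ 3)⁻¹ * S ^ 2 * T) with he
  have h0I : (0 : ℝ) ∈ Icc 0 T := left_mem_Icc.2 hT.le
  -- the stability bound in `ℝ≥0∞`
  set a : ℕ → ℝ≥0∞ := fun n => eLpNorm (u n 0 - u₀) 2 volume with ha
  have hbound : ∀ n m, ∀ t ∈ Icc 0 T, ∫⁻ x, ‖u n t x - u m t x‖ₑ ^ 2 ≤
      ENNReal.ofReal e * (2 * a n ^ 2 + 2 * a m ^ 2) := by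
    intro n m t ht
    have hmem : MemLp (fun x => u n t x - u m t x) 2 volume := ((hc n).1 t ht).sub ((hc m).1 t ht)
    have hmem0 : MemLp (fun x => u n 0 x - u m 0 x) 2 volume := ((hc n).1 0 h0I).sub ((hc m).1 0 h0I)
    have hreal := hstab hν hT (hsol n) (hsol m) (hu n) (hu' n) (hp n) (hu m) (hu' m) (hp m) (hS m) t ht
    have hexp : Real.exp (Cst * (ν ^ 3)⁻¹ * S ^ 2 * t) ≤ e := by
      rw [he]
      refine Real.exp_le_exp.2 (mul_le_mul_of_nonneg_left ht.2 ?_)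
      have : 0 ≤ (ν ^ 3)⁻¹ := inv_nonneg.2 (pow_nonneg hν.le 3)
      positivity
    have hI0 : 0 ≤ ∫ x, ‖u n 0 x - u m 0 x‖ ^ 2 := integral_nonneg fun _ => sq_nonneg _
    calc ∫⁻ x, ‖u n t x - u m t x‖ₑ ^ 2
        = ENNReal.ofReal (∫ x, ‖u n t x - u m t x‖ ^ 2) := lintegral_enorm_sq_eq_ofReal_integral hmem
      _ ≤ ENNReal.ofReal ((∫ x, ‖u n 0 x - u m 0 x‖ ^ 2) * e) :=
          ENNReal.ofReal_le_ofReal (hreal.trans (mul_le_mul_of_nonneg_left hexp hI0))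
      _ = ENNReal.ofReal e * ∫⁻ x, ‖u n 0 x - u m 0 x‖ₑ ^ 2 := by
          rw [mul_comm, ENNReal.ofReal_mul (Real.exp_pos _).le, lintegral_enorm_sq_eq_ofReal_integral hmem0]
      _ ≤ ENNReal.ofReal e * (2 * a n ^ 2 + 2 * a m ^ 2) := by
          gcongr
          have hsub : ∀ x, u n 0 x - u m 0 x = (u n 0 x - u₀ x) - (u m 0 x - u₀ x) := fun x => by abel
          simp_rw [hsub]
          refine (lintegral_enorm_sq_sub_le (((hc n).1 0 h0I).1.sub hu₀.1)).trans (le_of_eq ?_)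
          rw [ha]; dsimp only
          rw [← FluidPDE.eEnergy_eq_eLpNorm_sq, ← FluidPDE.eEnergy_eq_eLpNorm_sq]
          rfl
  -- the right-hand side tends to zero along `atTop ×ˢ atTop`
  have hF : Tendsto (fun q : ℕ × ℕ => ENNReal.ofReal e * (2 * a q.1 ^ 2 + 2 * a q.2 ^ 2)) atTop (𝓝 0) := by
    have hsq : Tendsto (fun n => a n ^ 2) atTop (𝓝 0) := by
      have h := ((ENNReal.continuous_pow 2).tendsto 0).comp h0
      rw [zero_pow two_ne_zero] at h
      exact h
    have h1 : Tendsto (fun q : ℕ × ℕ => a q.1 ^ 2) atTop (𝓝 0) := by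
      rw [← prod_atTop_atTop_eq]; exact hsq.comp tendsto_fst
    have h2 : Tendsto (fun q : ℕ × ℕ => a q.2 ^ 2) atTop (𝓝 0) := by
      rw [← prod_atTop_atTop_eq]; exact hsq.comp tendsto_snd
    have h3 : Tendsto (fun q : ℕ × ℕ => 2 * a q.1 ^ 2 + 2 * a q.2 ^ 2) atTop (𝓝 (2 * 0 + 2 * 0)) :=
      (ENNReal.Tendsto.const_mul h1 (Or.inr (by simp))).add (ENNReal.Tendsto.const_mul h2 (Or.inr (by simp)))
    rw [mul_zero, add_zero] at h3
    have h4 := ENNReal.Tendsto.const_mul h3 (Or.inr ENNReal.ofReal_ne_top) (a := ENNReal.ofReal e)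
    rwa [mul_zero] at h4
  intro ε hε
  by_cases hεtop : ε = ⊤
  · exact ⟨0, fun n _ m _ t _ => hεtop ▸ le_top⟩
  obtain ⟨N, hN⟩ := ENNReal.tendsto_atTop_zero.1 hF (ε ^ 2) (ENNReal.pow_pos hε 2)
  refine ⟨max N.1 N.2, fun n hn m hm t ht => eLpNorm_two_le_of_lintegral_le_sq ?_⟩
  have hq : N ≤ (n, m) := ⟨(le_max_left _ _).trans hn, (le_max_right _ _).trans hm⟩
  exact (hbound n m t ht).trans (hN (n, m) hq)

/-- **A smooth `H¹` representative of a slice of the limit**: if the smooth divergence-free slices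
`uⁿ(s)` have all Sobolev norms bounded uniformly in `n` and enstrophies `≤ S_b`, and converge in
`L²` to `v(s)`, then `v(s)` has a `C^∞` divergence-free representative `g ∈ H^∞` with
`∫|g|² + ∫|∇g|² ≤ ∫|v(s)|² + S_b` (`exists_smooth_representative` and the lower semicontinuity
of the weak dissipation, `eWeakGradL2Sq_le_liminf_of_tendsto_eLpNorm`). [cite: Tao2011, Prop. 5.6] -/
theorem exists_smooth_h1_rep {s : ℝ} {v : ℝ → (EuclideanSpace ℝ (Fin 3)) → (EuclideanSpace ℝ (Fin 3))} (hf : ∀ n, ContDiff ℝ ((⊤ : ℕ∞) : WithTop ℕ∞) (u n s))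
    (hdiv : ∀ n, VectorCalculus.IsDivFree (u n s)) (hmem : ∀ n, MemLp (u n s) 2 volume)
    {Cb : ℕ → ℝ≥0} (hCb : ∀ k n, ∫⁻ x, ‖iteratedFDeriv ℝ k (u n s) x‖ₑ ^ 2 ≤ Cb k)
    (hvs : MemLp (v s) 2 volume)
    (hconv : Tendsto (fun n => eLpNorm (u n s - v s) 2 volume) atTop (𝓝 0)) {Sb : ℝ≥0∞}
    (hSb : Sb ≠ ⊤)
    (hens : ∀ n, ∫⁻ x, ENNReal.ofReal (FluidPDE.frobeniusNormSq (fderiv ℝ (u n s) x)) ≤ Sb) :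
    ∃ g : (EuclideanSpace ℝ (Fin 3)) → (EuclideanSpace ℝ (Fin 3)), ContDiff ℝ ((⊤ : ℕ∞) : WithTop ℕ∞) g ∧ VectorCalculus.IsDivFree g ∧
      (∀ k : ℕ, ∫⁻ x, ‖iteratedFDeriv ℝ k g x‖ₑ ^ 2 < ⊤) ∧ g =ᵐ[volume] v s ∧
      (∫⁻ x, ‖g x‖ₑ ^ 2) + (∫⁻ x, ENNReal.ofReal (FluidPDE.frobeniusNormSq (fderiv ℝ g x))) ≤
        FluidPDE.eEnergy (v s) + Sb := by
  obtain ⟨g, hg1, hgae, hgb, hgdiv⟩ := exists_smooth_representative hf hCb hvs hconv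
  refine ⟨g, hg1, hgdiv hdiv, fun k => (hgb k).trans_lt ENNReal.coe_lt_top, hgae, add_le_add ?_ ?_⟩
  · exact (lintegral_congr_ae (hgae.mono fun x hx => by simp only [hx])).le
  · have hliminf : liminf (fun n => ∫⁻ x, ENNReal.ofReal
        (FluidPDE.frobeniusNormSq (fderiv ℝ (u n s) x))) atTop ≤ Sb :=
      liminf_le_of_frequently_le' (Frequently.of_forall hens)
    have hlsc := eWeakGradL2Sq_le_liminf_of_tendsto_eLpNorm (fun n => contDiff_infty.1 (hf n) 1) hmem
      hvs hconv (hliminf.trans_lt (lt_top_iff_ne_top.2 hSb))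
    have heq : eWeakGradL2Sq (v s) = ∫⁻ x, ENNReal.ofReal (FluidPDE.frobeniusNormSq (fderiv ℝ g x)) :=
      (eWeakGradL2Sq_congr_ae hgae.symm).trans
        (eWeakGradL2Sq_eq_of_hasWeakGradient (hasWeakGradient_fderiv_of_contDiff (contDiff_infty.1 hg1 1)))
    rw [← heq]
    exact hlsc.trans hliminf

end Scheme

/-! ## The assembly -/

section Main

set_option maxHeartbeats 1600000 in
/-- **Tao 2013, Theorem 5.4 (ii) for `H¹` data, from the smooth local theory** (Tao 2013,
Thm. 5.4 (i)–(iv), Lemma 5.5, Prop. 5.6; Leray 1934, §§31–33; Robinson–Rodrigo–Sadowski 2016,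
Thm. 6.8 / Cor. 6.9 / Thm. 7.3 / Thm. 8.17). Assume the smooth local existence statement
`tao2011_smooth_local_existence` (constant `c₁`). Let `c₂, K` be the constants of the enstrophy
a priori bound `exists_leray_enstrophy_apriori` and put `c = min(c₁, c₂, c₁/(1+K)²)`. For an
`H¹` divergence-free datum with `‖u₀‖²_{H¹} ≤ A` and `A²T ≤ cν³`: mollify (`mollify_h1_datum`,
data of size `≤ A` in `L² ⊕ Ḣ¹`), solve classically on `[0, T]` (`c ≤ c₁`), bound the
enstrophies by `KA` (`c ≤ c₂`) and all higher norms at positive times uniformly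
(`tao2011_quantitative_regularity_holds`), get the uniform `L²`-Cauchy property
(`uniform_cauchy_of_stability`) and the Leray–Hopf limit `v ∈ C([0,T]; L²)`
(`exists_isLerayHopfOn_of_uniform_cauchy`); at an a.e. restart time `s ∈ (τ/2, τ)`
(`IsLerayHopfOn.ae_isLerayHopfOn_restart`) the slice `v(s)` has a smooth `H^∞` representative
of size `≤ (1+K)A` (`exists_smooth_h1_rep`), from which the smooth theory restarts on
`[0, T - s]` (`c ≤ c₁/(1+K)²`) and reproduces `v` by weak–strong uniqueness
(`exists_classical_rep_of_restart`); `H¹`-regularity on `[0, T]` is `isH1RegularOn_of_rep`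
with the cubic enstrophy bound (`exists_enstrophy_cubic_ineq`). [cite: Tao2011, Thm. 5.4 (ii)] -/
theorem tao2011_H1_local_almost_regular_of_smooth_local_existence
    (hN1 : tao2011_smooth_local_existence) : tao2011_H1_local_almost_regular := by
  obtain ⟨c₁, hc₁, hloc⟩ := hN1
  obtain ⟨c₂, K, hc₂, hK, hPB⟩ := exists_leray_enstrophy_apriori
  obtain ⟨κ, hκ, hcubic⟩ := exists_enstrophy_cubic_ineq
  set c : ℝ := min (min c₁ c₂) (c₁ / (1 + K) ^ 2) with hc_def
  have hK1 : 0 < (1 + K) ^ 2 := by positivity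
  have hcpos : 0 < c := lt_min (lt_min hc₁ hc₂) (div_pos hc₁ hK1)
  have hcc₁ : c ≤ c₁ := (min_le_left _ _).trans (min_le_left _ _)
  have hcc₂ : c ≤ c₂ := (min_le_left _ _).trans (min_le_right _ _)
  have hcK : c ≤ c₁ / (1 + K) ^ 2 := min_le_right _ _
  refine ⟨c, hcpos, ?_⟩
  intro ν T hν hT u₀ hu₀ hdiv A hA hH1 hsmall
  have h0I : (0 : ℝ) ∈ Icc 0 T := left_mem_Icc.2 hT.le
  have hν3 : 0 < ν ^ 3 := pow_pos hν 3
  have hKA : 0 ≤ K * A := mul_nonneg hK.le hA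
  -- Step 0: the weak gradient of the datum
  obtain ⟨G₀, hG₀, -⟩ := exists_hasWeakGradient_of_eH1NormSq_lt (hH1.trans_lt ENNReal.ofReal_lt_top)
  have hWG : eWeakGradL2Sq u₀ = ∫⁻ x, ENNReal.ofReal (FluidPDE.frobeniusNormSq (G₀ x)) :=
    eWeakGradL2Sq_eq_of_hasWeakGradient hG₀
  have hsum : FluidPDE.eEnergy u₀ + ∫⁻ x, ENNReal.ofReal (FluidPDE.frobeniusNormSq (G₀ x)) ≤
      ENNReal.ofReal A := by
    rw [← hWG, ← eH1NormSq_def]; exact hH1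
  have hE0 : FluidPDE.eEnergy u₀ ≤ ENNReal.ofReal A := le_self_add.trans hsum
  have hG0A : ∫⁻ x, ENNReal.ofReal (FluidPDE.frobeniusNormSq (G₀ x)) ≤ ENNReal.ofReal A :=
    le_add_self.trans hsum
  have hG0top : ∫⁻ x, ENNReal.ofReal (FluidPDE.frobeniusNormSq (G₀ x)) < ⊤ :=
    hG0A.trans_lt ENNReal.ofReal_lt_top
  -- Step 1: mollified data
  obtain ⟨φ, hφ, -⟩ := exists_mollify_seq_tendsto hu₀ hG₀ hG0top
  have hdat := fun n => mollify_h1_datum (φ n) hu₀ hdiv hG₀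
  have hdatA : ∀ n, (∫⁻ x, ‖mollify (φ n) u₀ x‖ₑ ^ 2) +
      (∫⁻ x, ENNReal.ofReal (FluidPDE.frobeniusNormSq (fderiv ℝ (mollify (φ n) u₀) x))) ≤
        ENNReal.ofReal A :=
    fun n => (add_le_add (hdat n).2.2.2.1 (hdat n).2.2.2.2).trans hsum
  have hsmall₁ : A ^ 2 * T ≤ c₁ * ν ^ 3 := hsmall.trans (mul_le_mul_of_nonneg_right hcc₁ hν3.le)
  have hsmall₂ : A ^ 2 * T ≤ c₂ * ν ^ 3 := hsmall.trans (mul_le_mul_of_nonneg_right hcc₂ hν3.le)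
  -- Step 2: classical approximants on `[0, T]`
  have hex : ∀ n, ∃ (u : ℝ → (EuclideanSpace ℝ (Fin 3)) → (EuclideanSpace ℝ (Fin 3))) (p : ℝ → (EuclideanSpace ℝ (Fin 3)) → ℝ),
      FluidPDE.IsClassicalNSSolutionOn (Icc 0 T) ν 0 u p ∧ u 0 = mollify (φ n) u₀ ∧
      HasBoundedSobolevNormsOn (Icc 0 T) u ∧
      HasBoundedSobolevNormsOn (Icc 0 T) (FluidPDE.timeDerivWithin (Icc 0 T) u) ∧
      (∀ k : ℕ, ∃ C : ℝ≥0, ∀ t ∈ Icc 0 T, ∫⁻ x, ‖iteratedFDeriv ℝ k (p t) x‖ₑ ^ 2 ≤ C) ∧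
      FluidPDE.ContinuousInLpOn (Icc 0 T) 2 u :=
    fun n => hloc hν hT (hdat n).1 (hdat n).2.1 (hdat n).2.2.1 hA (hdatA n) hsmall₁
  choose u p hsol hu0 huB huB' hpB huc using hex
  have hmem : ∀ n, ∀ t ∈ Icc 0 T, MemLp (u n t) 2 volume := fun n => (huc n).1
  -- Step 3: the enstrophy a priori bound
  have hgrad0 : ∀ n, ∫⁻ x, ENNReal.ofReal (FluidPDE.frobeniusNormSq (fderiv ℝ (u n 0) x)) ≤
      ENNReal.ofReal A := fun n => by
    rw [hu0 n]; exact (hdat n).2.2.2.2.trans hG0A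
  have hPBn : ∀ n, (∀ t ∈ Icc 0 T, ∫⁻ x, ENNReal.ofReal (FluidPDE.frobeniusNormSq (fderiv ℝ (u n t) x)) ≤
      ENNReal.ofReal (K * A)) ∧ ENNReal.ofReal ν * ∫⁻ t in Ioo 0 T, ∫⁻ x,
        ‖iteratedFDeriv ℝ 2 (u n t) x‖ₑ ^ 2 ≤ ENNReal.ofReal (K * A) :=
    fun n => hPB hν hT (hsol n) (huB n) (huB' n) (hpB n) hA (hgrad0 n) hsmall₂
  have hensE : ∀ n, ∀ t ∈ Icc 0 T,
      ∫⁻ x, ENNReal.ofReal (FluidPDE.frobeniusNormSq (fderiv ℝ (u n t) x)) ≤ ((K * A).toNNReal : ℝ≥0∞) :=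
    fun n => (hPBn n).1
  have hensR : ∀ n, ∀ t ∈ Icc 0 T, ∫ x, FluidPDE.frobeniusNormSq (fderiv ℝ (u n t) x) ≤ K * A := by
    intro n t ht
    obtain ⟨-, -, -, hGeq⟩ := hcubic hν hT (hsol n) (huB n) (huB' n) (hpB n)
    have h := (hPBn n).1 t ht
    rw [← hGeq t ht] at h
    exact (ENNReal.ofReal_le_ofReal_iff hKA).1 h
  -- Step 4: energies of the data
  have hkin0 : ∀ n, VectorCalculus.kineticEnergy (u n 0) ≤ A / 2 := by
    intro n
    have h1 : FluidPDE.eEnergy (u n 0) ≤ ENNReal.ofReal A := by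
      rw [hu0 n]; exact (hdat n).2.2.2.1.trans hE0
    rw [FluidPDE.eEnergy_eq_ofReal _ (hmem n 0 h0I)] at h1
    have := (ENNReal.ofReal_le_ofReal_iff hA).1 h1
    linarith
  have h0' : Tendsto (fun n => eLpNorm (u n 0 - u₀) 2 volume) atTop (𝓝 0) := by
    have heq : (fun n => eLpNorm (u n 0 - u₀) 2 volume) = fun n => eLpNorm (mollify (φ n) u₀ - u₀) 2 volume :=
      funext fun n => by rw [hu0 n]
    rw [heq]; exact hφ
  -- Step 5: the uniform Cauchy property and the Leray–Hopf limit
  have hcau := uniform_cauchy_of_stability hν hT hsol huB huB' hpB huc hensR hu₀ h0'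
  obtain ⟨v, hLH, hv0, hcv, hconv⟩ := exists_isLerayHopfOn_of_uniform_cauchy hν hT hsol huB hpB huc
    hu₀ h0' hcau (M := A / 2) hkin0 (S := (K * A).toNNReal) hensE
  -- Step 6: uniform bounds of all orders at positive times
  have hE : ∀ n, ∀ t ∈ Icc 0 T, ∫⁻ x, ‖u n t x‖ₑ ^ 2 ≤ ((A.toNNReal : ℝ≥0) : ℝ≥0∞) := fun n t ht =>
    (lintegral_enorm_sq_le_of_taoClass hT hν.le (hsol n) (huB n) (hpB n) (huc n) ht).trans
      (ENNReal.ofReal_le_ofReal (by linarith [hkin0 n]))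
  have hI : ∀ n, ∫⁻ t in Ioo 0 T, ∫⁻ x, ‖iteratedFDeriv ℝ 2 (u n t) x‖ₑ ^ 2 ≤
      (((K * A / ν).toNNReal : ℝ≥0) : ℝ≥0∞) := by
    intro n
    have hν' : ENNReal.ofReal ν ≠ 0 := (ENNReal.ofReal_pos.2 hν).ne'
    have h3 : ∫⁻ t in Ioo 0 T, ∫⁻ x, ‖iteratedFDeriv ℝ 2 (u n t) x‖ₑ ^ 2 ≤
        ENNReal.ofReal (K * A) / ENNReal.ofReal ν := by
      rw [ENNReal.le_div_iff_mul_le (Or.inl hν') (Or.inl ENNReal.ofReal_ne_top), mul_comm]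
      exact (hPBn n).2
    refine h3.trans (le_of_eq ?_)
    rw [← ENNReal.ofReal_div_of_pos hν]
    rfl
  have hPA : ∀ τ' : ℝ, 0 < τ' → τ' < T → ∀ k : ℕ, ∃ C : ℝ≥0, ∀ n, ∀ t ∈ Icc τ' T,
      ∫⁻ x, ‖iteratedFDeriv ℝ k (u n t) x‖ₑ ^ 2 ≤ C := by
    intro τ' hτ' hτ'T k
    obtain ⟨C, hC⟩ := tao2011_quantitative_regularity_holds k hν hτ' hτ'T A.toNNReal (K * A).toNNReal
      (K * A / ν).toNNReal
    exact ⟨C, fun n t ht => hC (hsol n) (huB n) (huB' n) (hpB n) (hE n) (hensE n) (hI n) t ht⟩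
  -- Step 7: classical representatives on `[τ, T]`
  have hgood : ∀ᵐ s ∂(volume.restrict (Ioo 0 T)),
      FluidPDE.IsLerayHopfOn (T - s) ν 0 (v s) (fun t => v (t + s)) :=
    hLH.ae_isLerayHopfOn_restart hν.le
  have hclaim : ∀ τ ∈ Ioo 0 T, ∃ (w : ℝ → (EuclideanSpace ℝ (Fin 3)) → (EuclideanSpace ℝ (Fin 3))) (π : ℝ → (EuclideanSpace ℝ (Fin 3)) → ℝ),
      FluidPDE.IsClassicalNSSolutionOn (Icc τ T) ν 0 w π ∧ HasBoundedSobolevNormsOn (Icc τ T) w ∧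
      HasBoundedSobolevNormsOn (Icc τ T) (FluidPDE.timeDerivWithin (Icc τ T) w) ∧
      (∀ n : ℕ, ∃ C : ℝ≥0, ∀ t ∈ Icc τ T, ∫⁻ x, ‖iteratedFDeriv ℝ n (π t) x‖ₑ ^ 2 ≤ C) ∧
      (∀ t ∈ Icc τ T, v t =ᵐ[volume] w t) ∧
      ContinuousOn (fun t => ∫⁻ x, ENNReal.ofReal (FluidPDE.frobeniusNormSq (fderiv ℝ (w t) x)))
        (Icc τ T) := by
    intro τ hτ
    have hτ2 : 0 < τ / 2 := by linarith [hτ.1]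
    have hτ2T : τ / 2 < T := by linarith [hτ.2]
    choose Cb hCb using hPA (τ / 2) hτ2 hτ2T
    -- a good restart time in `(τ/2, τ)`
    obtain ⟨s, hs, hLHs⟩ := exists_mem_Ioo_of_ae_restrict (show τ / 2 < τ by linarith [hτ.1])
      (ae_restrict_of_ae_restrict_of_subset (Ioo_subset_Ioo hτ2.le hτ.2.le) hgood)
    have hsI : s ∈ Icc 0 T := ⟨by linarith [hs.1], by linarith [hs.2, hτ.2]⟩
    have hsτ' : s ∈ Icc (τ / 2) T := ⟨hs.1.le, hsI.2⟩
    -- the smooth `H¹` representative of `v s`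
    obtain ⟨g, hg1, hgdiv, hgfin, hgae, hgH1⟩ := exists_smooth_h1_rep (u := u) (s := s) (v := v)
      (fun n => (hsol n).contDiff_velocity hsI) (fun n => (hsol n).divFree s hsI)
      (fun n => hmem n s hsI) (Cb := Cb) (fun k n => hCb k n s hsτ') (hcv.1 s hsI) (hconv s hsI)
      (Sb := ENNReal.ofReal (K * A)) ENNReal.ofReal_ne_top (fun n => (hPBn n).1 s hsI)
    have hEs : FluidPDE.eEnergy (v s) ≤ ENNReal.ofReal A := by
      have hk : VectorCalculus.kineticEnergy (v s) ≤ A / 2 :=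
        le_of_tendsto' (tendsto_kineticEnergy_of_tendsto_eLpNorm_sub (fun n => hmem n s hsI)
          (hcv.1 s hsI) (hconv s hsI)) fun n =>
          (kineticEnergy_le_of_hasBoundedSobolevNormsOn hT hν.le (hsol n) (huB n) (hpB n) (huc n)
            le_rfl hsI.1 hsI.2).trans (hkin0 n)
      rw [FluidPDE.eEnergy_eq_ofReal _ (hcv.1 s hsI)]
      exact ENNReal.ofReal_le_ofReal (by linarith)
    have hA' : 0 ≤ (1 + K) * A := by positivity
    have hgA : (∫⁻ x, ‖g x‖ₑ ^ 2) +
        (∫⁻ x, ENNReal.ofReal (FluidPDE.frobeniusNormSq (fderiv ℝ g x))) ≤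
          ENNReal.ofReal ((1 + K) * A) := by
      refine hgH1.trans ?_
      rw [show (1 + K) * A = A + K * A by ring, ENNReal.ofReal_add hA hKA]
      exact add_le_add hEs le_rfl
    have hTs : 0 < T - s := by linarith [hs.2, hτ.2]
    have hsmall' : ((1 + K) * A) ^ 2 * (T - s) ≤ c₁ * ν ^ 3 := by
      calc ((1 + K) * A) ^ 2 * (T - s) ≤ ((1 + K) * A) ^ 2 * T :=
            mul_le_mul_of_nonneg_left (by linarith [hsI.1]) (sq_nonneg _)
        _ = (1 + K) ^ 2 * (A ^ 2 * T) := by ring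
        _ ≤ (1 + K) ^ 2 * (c * ν ^ 3) := mul_le_mul_of_nonneg_left hsmall hK1.le
        _ ≤ (1 + K) ^ 2 * (c₁ / (1 + K) ^ 2 * ν ^ 3) := by gcongr
        _ = c₁ * ν ^ 3 := by field_simp
    obtain ⟨W, P, hW, hW0, hWB, hWB', hPB', hWc⟩ := hloc hν hTs hg1 hgdiv hgfin hA' hgA hsmall'
    have hW0' : W 0 =ᵐ[volume] v s := by rw [hW0]; exact hgae
    exact exists_classical_rep_of_restart hν hs.2 hτ.2 (hcv.1 s hsI) hLHs hW hW0' hWB hWB' hPB' hWc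
  -- Step 8: `H¹`-regularity
  set D₀ : ℝ := (∫⁻ x, ENNReal.ofReal (FluidPDE.frobeniusNormSq (G₀ x))).toReal with hD₀def
  have hD₀ : eWeakGradL2Sq (v 0) = ENNReal.ofReal D₀ := by
    rw [hv0, hWG, hD₀def, ENNReal.ofReal_toReal hG0top.ne]
  have hup : ∀ t ∈ Icc 0 T, eWeakGradL2Sq (v t) ≤
      ENNReal.ofReal (D₀ + κ * (ν ^ 3)⁻¹ * (K * A) ^ 3 * t) := by
    intro t ht
    have hlsc := eWeakGradL2Sq_le_liminf_of_tendsto_eLpNorm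
      (fun n => contDiff_infty.1 ((hsol n).contDiff_velocity ht) 1) (fun n => hmem n t ht) (hcv.1 t ht)
      (hconv t ht) ((liminf_le_of_frequently_le' (Frequently.of_forall fun n => (hPBn n).1 t ht)).trans_lt
        ENNReal.ofReal_lt_top)
    refine hlsc.trans (liminf_le_of_frequently_le' (Frequently.of_forall fun n => ?_))
    obtain ⟨-, hcub, -, hGeq⟩ := hcubic hν hT (hsol n) (huB n) (huB' n) (hpB n)
    rw [← hGeq t ht]
    refine ENNReal.ofReal_le_ofReal ((hcub t ht).trans ?_)
    have h1 : ∫ x, FluidPDE.frobeniusNormSq (fderiv ℝ (u n 0) x) ≤ D₀ := by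
      rw [hD₀def, ← ENNReal.ofReal_le_iff_le_toReal hG0top.ne, hGeq 0 h0I, hu0 n]
      exact (hdat n).2.2.2.2
    have hG0 : ∀ τ, τ ∈ Icc 0 T → 0 ≤ ∫ x, FluidPDE.frobeniusNormSq (fderiv ℝ (u n τ) x) :=
      fun τ _ => integral_nonneg fun x => FluidPDE.frobeniusNormSq_nonneg _
    have h2 : ∫ τ in (0 : ℝ)..t, (∫ x, FluidPDE.frobeniusNormSq (fderiv ℝ (u n τ) x)) ^ 3 ≤
        (K * A) ^ 3 * t := by
      have hb : ∀ τ ∈ Ι (0 : ℝ) t, ‖(∫ x, FluidPDE.frobeniusNormSq (fderiv ℝ (u n τ) x)) ^ 3‖ ≤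
          (K * A) ^ 3 := by
        intro τ hτ
        rw [uIoc_of_le ht.1] at hτ
        have hτI : τ ∈ Icc 0 T := ⟨hτ.1.le, hτ.2.trans ht.2⟩
        rw [Real.norm_of_nonneg (pow_nonneg (hG0 τ hτI) 3)]
        exact pow_le_pow_left₀ (hG0 τ hτI) (hensR n τ hτI) 3
      have h := intervalIntegral.norm_integral_le_of_norm_le_const hb
      rw [sub_zero, abs_of_nonneg ht.1] at h
      exact (le_abs_self _).trans ((Real.norm_eq_abs _).symm.le.trans h)
    have hκν : 0 ≤ κ * (ν ^ 3)⁻¹ := mul_nonneg hκ.le (inv_nonneg.2 hν3.le)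
    calc (∫ x, FluidPDE.frobeniusNormSq (fderiv ℝ (u n 0) x)) + κ * (ν ^ 3)⁻¹ *
          ∫ τ in (0 : ℝ)..t, (∫ x, FluidPDE.frobeniusNormSq (fderiv ℝ (u n τ) x)) ^ 3
        ≤ D₀ + κ * (ν ^ 3)⁻¹ * ((K * A) ^ 3 * t) :=
          add_le_add h1 (mul_le_mul_of_nonneg_left h2 hκν)
      _ = D₀ + κ * (ν ^ 3)⁻¹ * (K * A) ^ 3 * t := by ring
  have hrep' : ∀ τ ∈ Ioo 0 T, ∃ w : ℝ → (EuclideanSpace ℝ (Fin 3)) → (EuclideanSpace ℝ (Fin 3)), (∀ t ∈ Icc τ T, ContDiff ℝ 1 (w t)) ∧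
      (∀ t ∈ Icc τ T, v t =ᵐ[volume] w t) ∧
      ContinuousOn (fun t => ∫⁻ x, ENNReal.ofReal (FluidPDE.frobeniusNormSq (fderiv ℝ (w t) x)))
        (Icc τ T) := by
    intro τ hτ
    obtain ⟨w, π, hw, -, -, -, hae, hcont⟩ := hclaim τ hτ
    exact ⟨w, fun t ht => contDiff_infty.1 (hw.contDiff_velocity ht) 1, hae, hcont⟩
  have hH1 : IsH1RegularOn (Icc 0 T) v := isH1RegularOn_of_rep hT hcv hrep' hD₀ hup
  -- conclusion
  refine ⟨v, hLH, hv0, hH1, fun τ hτ => ?_⟩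
  obtain ⟨w, π, h1, h2, h3, h4, h5, -⟩ := hclaim τ hτ
  exact ⟨w, π, h1, h2, h3, h4, h5⟩

end Main

end Literature.Analysis.FluidPDE

end
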